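import Summits.QuantumFields.YangMills.Theorems.LuscherReductionOneSiteLevelsAbsLowerPrep
import Summits.QuantumFields.YangMills.Theorems.LuscherReductionOneSiteLevelsVariational

/-!
# AbsLower: absolute quasimode floors for every one-site zero-flux transfer level, GIVEN the eigenfunctions of `𝔥`
# (the registered stub `stub_absLower` of crux `OneSiteLevels`, route `LuscherReduction`, item stmt-QuantumFields-20007,
# CONDITIONAL on the named Literature fact `LuscherHamiltonianEigenfunctions k` (AL1); fleet seat prover ym-luscher-20007-p2)

`oneSiteAbsLower_of_eigenfunctions`: if Lüscher's matrix-model Hamiltonian `𝔥 = −½Δ + V` has smooth, colour-invariant,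
`L²`-orthonormal, exponentially decaying eigenfunctions realising its first `k+1` invariant min–max levels (the printed theorem
recorded as the tree's named fact `LuscherHamiltonianEigenfunctions k`, p441424), then there are `C, B₀` with

  `linkC B ^ 3 · exp(−physLevel(k+1)·λ_b − C λ_b²) ≤ levelValue su2Rep 1 B k`   for all `B ≥ B₀`,

`linkC B = ∫_{SU(2)} e^{B Re tr W} dW` (= `oneLinkFactor B` of the skeleton, `rfl`), `λ_b = bareLambda B = (2/B)^{1/3}` — i.e.
`LuscherHamiltonianEigenfunctions k → OneSiteAbsLower k` for the registered skeleton (v5/v6).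

Proof = the quasimode door `le_levelValue_of_subspace` (Courant–Fischer lower-bound principle, `…Variational`) applied to the
`(k+1)`-dimensional space of gnomonic pull-backs `trialMap f R (λ_b/2) a = (χ_R · Σ_j a_j f_j) ∘ gnCoord (λ_b/2)`, `R = 1/(4λ_b)`,
with the per-trial-state estimate `trial_estimate` (Strang/Gaussian comparison of the transfer kernel in the gnomonic chart +
lit g6's `quasimode_estimate`), the `‖Ψ‖²` window bounds of `…GnForms`, and the sharp normaliser bound `linkC_pow_three_le_gauss`.

## WHAT THIS IS NOT
Conditional on AL1 (a `def … : Prop` named fact: Reed–Simon XIII.64 + Agmon + elliptic regularity); NOT the hard half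
`stub_absUpper`; NOT THE CLAY GAP.  Sorry-free.
-/

set_option autoImplicit false

noncomputable section

open MeasureTheory Filter Topology Real
open scoped Matrix ENNReal
open Literature.MathematicalPhysics.QuantumFieldTheory
open Literature.MathematicalPhysics.QuantumLattice
open Literature.Analysis.OperatorTheory.YMMatrixModel

namespace Summit.QuantumFields.YangMills.Theorems.FemtoTransferGap

section AbsLower

variable {k : ℕ}

/-- `Bλ_b³ = 2` read at `μ = λ_b/2`: `Bμ³ = 1/4`. [folklore] -/
theorem bareLambda_half_cube {B : ℝ} (hB : 0 < B) : B * (bareLambda B / 2) ^ 3 = 1 / 4 := by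
  have h := bareLambda_cube hB
  rw [div_pow]; nlinarith [h]

/-- The final elementary inequality: for `0 ≤ 2μE + μ²K ≤ 1/2` and `0 < μ ≤ 1`,
`exp(−E·(2μ) − C·(2μ)²) ≤ 1 − 2μE − μ²K` with `C = (K + 2(2E+K)²)/4`. [folklore] -/
theorem exp_le_one_sub {μ E K : ℝ} (hμ : 0 < μ) (hμ1 : μ ≤ 1) (hE : 0 ≤ E) (hK : 0 ≤ K) (ht : 2 * μ * E + μ ^ 2 * K ≤ 1 / 2) :
    Real.exp (-(E * (2 * μ)) - (K + 2 * (2 * E + K) ^ 2) / 4 * (2 * μ) ^ 2) ≤ 1 - 2 * μ * E - μ ^ 2 * K := by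
  set t := 2 * μ * E + μ ^ 2 * K with htdef
  have ht0 : 0 ≤ t := by positivity
  have h := exp_neg_sub_two_sq_le ht0 ht
  have hmono : -(E * (2 * μ)) - (K + 2 * (2 * E + K) ^ 2) / 4 * (2 * μ) ^ 2 ≤ -t - 2 * t ^ 2 := by
    -- `t² ≤ μ²(2E+K)²` since `μ ≤ 1`
    have h1 : t ≤ μ * (2 * E + K) := by
      rw [htdef]; nlinarith [mul_le_mul_of_nonneg_left hμ1 (mul_nonneg hμ.le hK)]
    have h2 : t ^ 2 ≤ μ ^ 2 * (2 * E + K) ^ 2 := by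
      rw [← mul_pow]; exact pow_le_pow_left₀ ht0 h1 2
    rw [htdef] at h2 ⊢
    nlinarith
  calc Real.exp (-(E * (2 * μ)) - (K + 2 * (2 * E + K) ^ 2) / 4 * (2 * μ) ^ 2) ≤ Real.exp (-t - 2 * t ^ 2) :=
        Real.exp_le_exp.2 hmono
    _ ≤ 1 - t := h
    _ = 1 - 2 * μ * E - μ ^ 2 * K := by rw [htdef]; ring

/-- **The variational core.**  For eigenfunction data as in `trial_estimate` and a chart scale `μ` satisfying the smallness
conditions, `linkC B ^ 3 · (1 − 2μE − μ²K) ≤ levelValue su2Rep 1 B k` (`E = physLevel (k+1)`, `K = absLowerK …`), by the door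
`le_levelValue_of_subspace` on the `(k+1)`-dimensional space of gnomonic pull-backs of the cut-off spans. [folklore] -/
theorem linkC_pow_three_mul_le_levelValue {f : Fin (k + 1) → ZM → ℝ} (hsmooth : ∀ j, ∀ n : ℕ∞, ContDiff ℝ n (f j))
    (hinv : ∀ j, IsGaugeInv (f j)) {Cf : ℝ} (hCf : ∀ j x, |f j x| ≤ Cf * Real.exp (-‖x‖)) {A : ℝ} (hA0 : 0 ≤ A)
    (hq : ∀ R : ℝ, 1 ≤ R → ∀ a : Fin (k + 1) → ℝ,
      energyForm (radialCutoff R * fun x => ∑ j, a j * f j x) ≤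
          physLevel (k + 1) * l2sq (radialCutoff R * fun x => ∑ j, a j * f j x) + A * Real.exp (-R) * ∑ i, ∑ j, |a i| * |a j| ∧
      ∑ j, a j ^ 2 - A * Real.exp (-R) * ∑ i, ∑ j, |a i| * |a j| ≤ l2sq (radialCutoff R * fun x => ∑ j, a j * f j x))
    {B μ : ℝ} (hB : 0 < B) (hμ : 0 < μ) (hBμ : B * μ ^ 3 = 1 / 4) (hμ8 : μ ≤ 1 / 8) (hεμ : A * (k + 1) * (3072 * μ ^ 3) ≤ 1 / 2)
    (hBπ : π ≤ B)
    (ht : 0 ≤ 1 - 2 * μ * physLevel (k + 1) - μ ^ 2 * absLowerK (physLevel (k + 1)) A ((k + 1) * Cf ^ 2 * ∫ y : ZM, Real.exp (-‖y‖)) k) :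
    linkC B ^ 3 * (1 - 2 * μ * physLevel (k + 1) - μ ^ 2 * absLowerK (physLevel (k + 1)) A ((k + 1) * Cf ^ 2 * ∫ y : ZM, Real.exp (-‖y‖)) k)
      ≤ levelValue su2Rep 1 B k := by
  have hR0 : 0 < 1 / (8 * μ) := by positivity
  have hR1 : 1 ≤ 1 / (8 * μ) := by rw [le_div_iff₀ (by positivity)]; linarith
  have hcc0 : 0 < μ ^ 9 * ((2 * π ^ 2)⁻¹) ^ 3 := by positivity
  have hwin6 : 1 - 6 * (μ ^ 2 * (Real.sqrt 2 * (1 / (8 * μ))) ^ 2) = 13 / 16 := by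
    rw [sq_sqrt_two_mul]
    have : μ * (1 / (8 * μ)) = 1 / 8 := by field_simp
    rw [this]; norm_num
  -- per-`a` facts
  have hGtest : ∀ a, IsTestFn (cutSpan f (1 / (8 * μ)) a) ∧ IsGaugeInv (cutSpan f (1 / (8 * μ)) a) := fun a =>
    isTestFn_isGaugeInv_radialCutoff_mul_span hR0 hsmooth hinv a
  have hGb : ∀ a, ∃ C : ℝ, ∀ x, |cutSpan f (1 / (8 * μ)) a x| ≤ C := fun a => by
    obtain ⟨C, _, hC⟩ := GaussForm.exists_bound_of_hasCompactSupport (hGtest a).1.continuous (hGtest a).1.2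
    exact ⟨C, hC⟩
  have hsupp : ∀ a y, cutSpan f (1 / (8 * μ)) a y ≠ 0 → ‖y‖ ≤ Real.sqrt 2 * (1 / (8 * μ)) := fun a y hy =>
    norm_le_of_cutSpan_ne_zero f hR0 a hy
  have hl2lo : ∀ a, 8 * (μ ^ 9 * ((2 * π ^ 2)⁻¹) ^ 3 * (13 / 16)) * ∫ y, cutSpan f (1 / (8 * μ)) a y ^ 2 ≤
      l2 (trialMap f (1 / (8 * μ)) μ a) (trialMap f (1 / (8 * μ)) μ a) := fun a => by
    have h := le_l2_gnPullback hμ (hGtest a).1.continuous.measurable (hGb a) (hGtest a).1.integrable_sq (hsupp a)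
    rw [hwin6] at h; exact h
  have hl2hi : ∀ a, l2 (trialMap f (1 / (8 * μ)) μ a) (trialMap f (1 / (8 * μ)) μ a) ≤
      8 * (μ ^ 9 * ((2 * π ^ 2)⁻¹) ^ 3) * ∫ y, cutSpan f (1 / (8 * μ)) a y ^ 2 := fun a =>
    l2_gnPullback_le hμ (hGtest a).1.continuous.measurable (hGb a) (hGtest a).1.integrable_sq
  -- `N ≥ n2/2`
  have hNlo : ∀ a, (∑ j, a j ^ 2) / 2 ≤ ∫ y, cutSpan f (1 / (8 * μ)) a y ^ 2 := by
    intro a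
    obtain ⟨-, h2⟩ := hq (1 / (8 * μ)) hR1 a
    have hl2sq : l2sq (radialCutoff (1 / (8 * μ)) * fun x => ∑ j, a j * f j x) = ∫ y, cutSpan f (1 / (8 * μ)) a y ^ 2 := rfl
    rw [hl2sq] at h2
    have hSn := sum_abs_mul_abs_le a
    have heR : Real.exp (-(1 / (8 * μ))) ≤ 3072 * μ ^ 3 := by
      refine (Literature.Barriers.AtomisticToContinuum.exp_neg_le_six_div_cube hR0).trans (le_of_eq ?_); field_simp; ring
    have hn20 : 0 ≤ ∑ j, a j ^ 2 := Finset.sum_nonneg fun j _ => sq_nonneg _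
    have : A * Real.exp (-(1 / (8 * μ))) * ∑ i, ∑ j, |a i| * |a j| ≤ (1 / 2) * ∑ j, a j ^ 2 := by
      calc A * Real.exp (-(1 / (8 * μ))) * ∑ i, ∑ j, |a i| * |a j|
          ≤ A * Real.exp (-(1 / (8 * μ))) * ((k + 1) * ∑ j, a j ^ 2) := mul_le_mul_of_nonneg_left hSn (by positivity)
        _ ≤ A * (3072 * μ ^ 3) * ((k + 1) * ∑ j, a j ^ 2) := by gcongr
        _ = A * (k + 1) * (3072 * μ ^ 3) * ∑ j, a j ^ 2 := by ring
        _ ≤ (1 / 2) * ∑ j, a j ^ 2 := mul_le_mul_of_nonneg_right hεμ hn20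
    linarith
  -- positivity of the norm on the trial space, injectivity, dimension
  have hpos : ∀ a, a ≠ 0 → 0 < l2 (trialMap f (1 / (8 * μ)) μ a) (trialMap f (1 / (8 * μ)) μ a) := by
    intro a ha
    have hn2 : 0 < ∑ j, a j ^ 2 := by
      obtain ⟨j, hj⟩ := Function.ne_iff.1 ha
      have h2 : 0 < a j ^ 2 := by rw [← sq_abs]; exact pow_pos (abs_pos.2 hj) 2
      exact lt_of_lt_of_le h2 (Finset.single_le_sum (fun i _ => sq_nonneg (a i)) (Finset.mem_univ j))
    have h1 := hl2lo a
    have hN := hNlo a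
    have : 0 < 8 * (μ ^ 9 * ((2 * π ^ 2)⁻¹) ^ 3 * (13 / 16)) * ∫ y, cutSpan f (1 / (8 * μ)) a y ^ 2 :=
      mul_pos (by positivity) (by linarith)
    linarith
  have hinj : Function.Injective (trialMap f (1 / (8 * μ)) μ) := by
    intro a b hab
    by_contra hne
    have h : trialMap f (1 / (8 * μ)) μ (a - b) = 0 := by rw [map_sub, hab, sub_self]
    have := hpos (a - b) (sub_ne_zero.2 hne)
    rw [h] at this
    simp [l2] at this
  have hfin : Module.finrank ℝ (LinearMap.range (trialMap f (1 / (8 * μ)) μ)) = k + 1 := by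
    rw [LinearMap.finrank_range_of_inj hinj]; simp
  have hadm : ∀ ψ ∈ LinearMap.range (trialMap f (1 / (8 * μ)) μ), IsPhys ψ := by
    rintro ψ ⟨a, rfl⟩
    exact isPhys_gnPullback (hGtest a).1.continuous.measurable (hGb a) (hGtest a).2 μ
  have hl2W : ∀ ψ ∈ LinearMap.range (trialMap f (1 / (8 * μ)) μ), ψ ≠ 0 → 0 < l2 ψ ψ := by
    rintro ψ ⟨a, rfl⟩ hne
    exact hpos a fun h => hne (by rw [h, map_zero])
  -- the Rayleigh bound on the trial space
  have hlink : linkC B ^ 3 ≤ Real.exp (6 * B) * (Real.sqrt (π / (B * μ ^ 2)) ^ 9 * (μ ^ 9 * ((2 * π ^ 2)⁻¹) ^ 3)) := by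
    have h := linkC_pow_three_le_gauss hB
    have e : Real.sqrt (π / (B * μ ^ 2)) ^ 9 * (μ ^ 9 * ((2 * π ^ 2)⁻¹) ^ 3) = Real.sqrt (π / B) ^ 9 / (2 * π ^ 2) ^ 3 := by
      rw [← mul_assoc, sqrt_div_mul_sq_pow_mul B μ hB hμ]; ring
    rw [e, ← mul_div_assoc]; exact h
  have hlink0 : 0 ≤ linkC B ^ 3 := pow_nonneg (linkC_pos hB.le).le 3
  have hmain : ∀ ψ ∈ LinearMap.range (trialMap f (1 / (8 * μ)) μ),
      linkC B ^ 3 * (1 - 2 * μ * physLevel (k + 1) - μ ^ 2 * absLowerK (physLevel (k + 1)) A ((k + 1) * Cf ^ 2 * ∫ y : ZM, Real.exp (-‖y‖)) k)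
        * l2 ψ ψ ≤ qform su2Rep B ψ ψ := by
    rintro ψ ⟨a, rfl⟩
    have hN0 : 0 ≤ ∫ y, cutSpan f (1 / (8 * μ)) a y ^ 2 := integral_nonneg fun y => sq_nonneg _
    have htrial := trial_estimate hsmooth hinv hCf hA0 hq hB hμ hBμ hμ8 hεμ hBπ a
    refine le_trans ?_ htrial
    have h2 := hl2hi a
    calc linkC B ^ 3 * (1 - 2 * μ * physLevel (k + 1) - μ ^ 2 * absLowerK (physLevel (k + 1)) A ((k + 1) * Cf ^ 2 * ∫ y : ZM, Real.exp (-‖y‖)) k)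
          * l2 (trialMap f (1 / (8 * μ)) μ a) (trialMap f (1 / (8 * μ)) μ a)
        ≤ linkC B ^ 3 * (1 - 2 * μ * physLevel (k + 1) - μ ^ 2 * absLowerK (physLevel (k + 1)) A ((k + 1) * Cf ^ 2 * ∫ y : ZM, Real.exp (-‖y‖)) k)
          * (8 * (μ ^ 9 * ((2 * π ^ 2)⁻¹) ^ 3) * ∫ y, cutSpan f (1 / (8 * μ)) a y ^ 2) :=
          mul_le_mul_of_nonneg_left h2 (mul_nonneg hlink0 ht)
      _ ≤ Real.exp (6 * B) * (Real.sqrt (π / (B * μ ^ 2)) ^ 9 * (μ ^ 9 * ((2 * π ^ 2)⁻¹) ^ 3))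
          * (1 - 2 * μ * physLevel (k + 1) - μ ^ 2 * absLowerK (physLevel (k + 1)) A ((k + 1) * Cf ^ 2 * ∫ y : ZM, Real.exp (-‖y‖)) k)
          * (8 * (μ ^ 9 * ((2 * π ^ 2)⁻¹) ^ 3) * ∫ y, cutSpan f (1 / (8 * μ)) a y ^ 2) :=
          mul_le_mul_of_nonneg_right (mul_le_mul_of_nonneg_right hlink ht) (mul_nonneg (by positivity) hN0)
      _ = 8 * Real.exp (6 * B) * Real.sqrt (π / (B * μ ^ 2)) ^ 9 * (μ ^ 9 * ((2 * π ^ 2)⁻¹) ^ 3) ^ 2 *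
          (∫ y, cutSpan f (1 / (8 * μ)) a y ^ 2) *
          (1 - 2 * μ * physLevel (k + 1) - μ ^ 2 * absLowerK (physLevel (k + 1)) A ((k + 1) * Cf ^ 2 * ∫ y : ZM, Real.exp (-‖y‖)) k) := by
          ring
  exact le_levelValue_of_subspace su2Rep continuous_su2Rep B (LinearMap.range (trialMap f (1 / (8 * μ)) μ)) hfin hadm hl2W hmain

/-- `(x^{1/3})³ = x` for `x ≥ 0`, in the form used for the thresholds. [folklore] -/
theorem pow_three_le_of_le_rpow_third {μ x : ℝ} (hμ : 0 ≤ μ) (hx : 0 ≤ x) (h : μ ≤ x ^ ((1:ℝ) / 3)) : μ ^ 3 ≤ x := by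
  have h3 := pow_le_pow_left₀ hμ h 3
  have e : (x ^ ((1:ℝ) / 3)) ^ 3 = x := by
    rw [← Real.rpow_natCast, ← Real.rpow_mul hx]; norm_num
  rwa [e] at h3

/-- **AbsLower from the eigenfunctions of `𝔥` (the quasimode half of crux ONE, conditional on AL1).**
[cite: Luscher1983, §1–§3] [cite: ReedSimonIV1978, Thm. XIII.1–2] -/
theorem oneSiteAbsLower_of_eigenfunctions (hAL : LuscherHamiltonianEigenfunctions k) :
    ∃ C B0 : ℝ, ∀ B : ℝ, B0 ≤ B →
      linkC B ^ 3 * Real.exp (-(physLevel (k + 1) * bareLambda B) - C * bareLambda B ^ 2) ≤ levelValue su2Rep 1 B k := by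
  obtain ⟨f, hsmooth, hinv, -, -, hdec, A, hA0, hq⟩ := hAL.quasimodes
  obtain ⟨Cf, -, hCf⟩ := exists_uniform_decay hdec
  have hE0 : 0 ≤ physLevel (k + 1) := physLevel_nonneg (Nat.succ_le_succ (Nat.zero_le k))
  have hMom0 : 0 ≤ (k + 1) * Cf ^ 2 * ∫ y : ZM, Real.exp (-‖y‖) := by
    have : 0 ≤ ∫ y : ZM, Real.exp (-‖y‖) := integral_nonneg fun y => (Real.exp_pos _).le
    positivity
  have hK0 := absLowerK_nonneg hE0 hA0 hMom0 k
  -- abbreviate the two constants by universally quantified statements (no `set`, to keep terms syntactically uniform)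
  generalize hE : physLevel (k + 1) = E at hE0 hK0 ⊢
  generalize hK : absLowerK E A ((k + 1) * Cf ^ 2 * ∫ y : ZM, Real.exp (-‖y‖)) k = K at hK0 ⊢
  -- thresholds
  have hth1 : 0 < (1 / (2 * (A * (k + 1) * 3072 + 1))) := by positivity
  have hth2 : 0 < 1 / (4 * π) := by positivity
  obtain ⟨μ0, hμ0pos, hμ0a, hμ0b, hμ0c, hμ0d⟩ : ∃ μ0 : ℝ, 0 < μ0 ∧ μ0 ≤ 1 / 8 ∧
      μ0 ≤ (1 / (2 * (A * (k + 1) * 3072 + 1))) ^ ((1:ℝ) / 3) ∧ μ0 ≤ (1 / (4 * π)) ^ ((1:ℝ) / 3) ∧ μ0 ≤ 1 / (4 * (2 * E + K + 1)) := by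
    refine ⟨min (1 / 8) (min ((1 / (2 * (A * (k + 1) * 3072 + 1))) ^ ((1:ℝ) / 3)) (min ((1 / (4 * π)) ^ ((1:ℝ) / 3)) (1 / (4 * (2 * E + K + 1))))),
      ?_, min_le_left _ _, (min_le_right _ _).trans (min_le_left _ _),
      (min_le_right _ _).trans ((min_le_right _ _).trans (min_le_left _ _)),
      (min_le_right _ _).trans ((min_le_right _ _).trans (min_le_right _ _))⟩
    exact lt_min (by norm_num) (lt_min (Real.rpow_pos_of_pos hth1 _) (lt_min (Real.rpow_pos_of_pos hth2 _) (by positivity)))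
  refine ⟨(K + 2 * (2 * E + K) ^ 2) / 4, 2 / (2 * μ0) ^ 3, fun B hBge => ?_⟩
  have hB : 0 < B := lt_of_lt_of_le (by positivity) hBge
  have hlam0 : 0 < bareLambda B := bareLambda_pos' hB
  have hlamle : bareLambda B ≤ 2 * μ0 := bareLambda_le_of_le (by positivity) hBge
  -- `μ = λ_b / 2`
  obtain ⟨μ, hμdef⟩ : ∃ μ : ℝ, bareLambda B = 2 * μ := ⟨bareLambda B / 2, by ring⟩
  have hμ : 0 < μ := by linarith
  have hμle : μ ≤ μ0 := by linarith
  have hBμ : B * μ ^ 3 = 1 / 4 := by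
    have := bareLambda_half_cube hB
    rw [hμdef, show 2 * μ / 2 = μ by ring] at this; exact this
  have hμ8 : μ ≤ 1 / 8 := hμle.trans hμ0a
  have hμ1 : μ ≤ 1 := by linarith
  have hεμ : A * (k + 1) * (3072 * μ ^ 3) ≤ 1 / 2 := by
    have h2 := pow_three_le_of_le_rpow_third hμ.le hth1.le (hμle.trans hμ0b)
    have h3 : A * (k + 1) * 3072 * μ ^ 3 ≤ A * (k + 1) * 3072 * (1 / (2 * (A * (k + 1) * 3072 + 1))) :=
      mul_le_mul_of_nonneg_left h2 (by positivity)
    have h4 : A * (k + 1) * 3072 * (1 / (2 * (A * (k + 1) * 3072 + 1))) ≤ 1 / 2 := by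
      rw [mul_one_div, div_le_iff₀ (by positivity)]; nlinarith [mul_nonneg hA0 (by positivity : (0:ℝ) ≤ (k:ℝ) + 1)]
    nlinarith
  have hBπ : π ≤ B := by
    have h2 := pow_three_le_of_le_rpow_third hμ.le hth2.le (hμle.trans hμ0c)
    have h3 : B = 1 / (4 * μ ^ 3) := by field_simp; nlinarith [hBμ]
    rw [h3, le_div_iff₀ (by positivity)]
    have := mul_le_mul_of_nonneg_left h2 (by positivity : (0:ℝ) ≤ 4 * π)
    rw [mul_one_div, div_self (by positivity)] at this
    nlinarith [Real.pi_pos]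
  have ht : 2 * μ * E + μ ^ 2 * K ≤ 1 / 2 := by
    have h1 : μ ≤ 1 / (4 * (2 * E + K + 1)) := hμle.trans hμ0d
    have h2 : μ * (2 * E + K + 1) ≤ 1 / 4 := by rw [le_div_iff₀ (by positivity)] at h1; linarith
    nlinarith [mul_nonneg hμ.le hK0, sq_nonneg μ]
  have ht0 : 0 ≤ 1 - 2 * μ * E - μ ^ 2 * K := by linarith
  have hcore := linkC_pow_three_mul_le_levelValue hsmooth hinv hCf hA0 hq hB hμ hBμ hμ8 hεμ hBπ
  rw [hE, hK] at hcore
  have hexp : Real.exp (-(E * bareLambda B) - (K + 2 * (2 * E + K) ^ 2) / 4 * bareLambda B ^ 2) ≤ 1 - 2 * μ * E - μ ^ 2 * K := by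
    rw [hμdef]; exact exp_le_one_sub hμ hμ1 hE0 hK0 ht
  calc linkC B ^ 3 * Real.exp (-(E * bareLambda B) - (K + 2 * (2 * E + K) ^ 2) / 4 * bareLambda B ^ 2)
      ≤ linkC B ^ 3 * (1 - 2 * μ * E - μ ^ 2 * K) := mul_le_mul_of_nonneg_left hexp (pow_nonneg (linkC_pos hB.le).le 3)
    _ ≤ levelValue su2Rep 1 B k := hcore ht0

end AbsLower

end Summit.QuantumFields.YangMills.Theorems.FemtoTransferGap

end
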